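import Summits.BirchSwinnertonDyer.BirchSwinnertonDyer.Theorems.TeichmullerTwistDescentStarInvolutionSandwich
import Summits.BirchSwinnertonDyer.BirchSwinnertonDyer.Theorems.TeichmullerTwistDescentTwistedPeriodLatticeIndexFrame
import HarnessLib

/-!
# The twist frame of a conductor-level datum at a potentially good additive prime
# (route `TeichmullerTwistDescent`, LINE 11, K stmt-BirchSwinnertonDyer-25368)

Cell `pub/bsd-wall`, seat `bsd-line-ttd-p1` (g5). THEOREMS ONLY (no definition, no named fact), theses-cone
free. One packaging theorem, `exists_twist_frame`, used by
`TeichmullerTwistDescentTwistedPeriodLatticeDichotomy.lean` twice (the dichotomy and its converse): for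
`W/ℚ` globally minimal, additive and potentially good at `p ≥ 5` with `ord_p Δ_min < 6`, `E[p]`
irreducible, `D` a conductor-level datum (`p² ∣ N`), GRANTED modularity (`exists_isNewformOf`) — a minimal
model `V` of the `p*`-twist (`C • W^{(p*)} = V`, `ord_p u(C) = 0`), a Néron period pair `L_V`, and the
`X₀(N)`-optimal member `W₀` of the class of `V` with a lattice-optimal datum `D₀` at level `N(W)` whose
newform is the twisted form `f_D ⊗ χ_p` (q-expansion comparison `aₙ(V) = χ_p(n) aₙ(W)`); `E[p]` stays
irreducible for `V`. All ingredients are tree theorems (`exists_minimal_twist_pStar`,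
`conductorNorm_eq_of_twist_pStar`, `X12.exists_isIsogenous_optimal`, `cuspCoeff_charTwist`,
`eq_of_forall_cuspCoeff_eq_gamma0`, Burungale–Skinner–Tian–Wan's twist lemma). BSD is not proved by this.
[cite: Stevens1989, §5 pp. 96–97] [cite: PastenShimura2024, §2 p. 12]
-/

set_option autoImplicit false
-- single-conjunct summit: `Summit.BirchSwinnertonDyer.BirchSwinnertonDyer.…` repeats the name by design
set_option linter.dupNamespace false

noncomputable section

open scoped Classical NumberField

open WeierstrassCurve IsDedekindDomain Rat.HeightOneSpectrum Literature.NumberTheory.EllipticCurves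
  Literature.NumberTheory.EllipticCurves.ModularForms Literature.NumberTheory.EllipticCurves.Rank1Residual
  Summit.BirchSwinnertonDyer.Rank1Residual Summit.BirchSwinnertonDyer.Rank1Residual.Additive
  Summit.BirchSwinnertonDyer.BirchSwinnertonDyer.Theorems.TeichmullerTwistDescentStarInvolution

namespace Summit.BirchSwinnertonDyer.BirchSwinnertonDyer.Theorems.TeichmullerTwistDescent.TwistFrame

/-! ### §1 The twist frame: `V`, `W₀`, `D₀` -/

/-- Level bookkeeping: a lattice-optimal datum at level `N` is one at any equal level. [folklore] -/
private theorem exists_optimalDatum_of_level_eq' {X : WeierstrassCurve ℚ} {N M : ℕ} [NeZero N]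
    [NeZero M] (h : N = M) (D : ModularParametrizationData X N)
    (hopt : ∀ z ∈ D.L.lattice, ∃ w ∈ periodLattice D.f, z = D.c * w) :
    ∃ D' : ModularParametrizationData X M, ∀ z ∈ D'.L.lattice, ∃ w ∈ periodLattice D'.f, z = D'.c * w := by
  subst h
  exact ⟨D, hopt⟩

/-- **The twist frame.** For `W/ℚ` globally minimal, additive and potentially good at the prime `p ≥ 5`
with `ord_p Δ_min < 6` and `E[p]` irreducible, `D` a conductor-level datum of `W` (`p² ∣ N`), and `χ`
the quadratic character mod `p`, GRANTED modularity: there are a globally minimal model `V` of the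
`p*`-twist, `C • W^{(p*)} = V` with `ord_p u(C) = 0` (the tree's `exists_minimal_twist_pStar`,
`padicValRat_u_eq_zero_and_padicValInt_eq_of_twist_pStar`), a Néron period pair `L_V` of `V`, and the
`X₀(N)`-optimal member `W₀` of the `ℚ`-isogeny class of `V` with a LATTICE-OPTIMAL datum `D₀` at level
`N = N(W)` (`X12.exists_isIsogenous_optimal`; `N(V) = N(W)` by `conductorNorm_eq_of_twist_pStar`) whose
newform IS the twist: `f_D ⊗ χ = f_{D₀}` (`aₙ(V) = χ(n) aₙ(W)`, additivity of both at `p`, strong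
multiplicity one `eq_of_forall_cuspCoeff_eq_gamma0`); `E[p]` stays irreducible for `V`
(Burungale–Skinner–Tian–Wan's twist lemma). [cite: Stevens1989, §5 p. 96–97]
[cite: PastenShimura2024, §2 p. 12] -/
theorem exists_twist_frame (hnf : exists_isNewformOf) (W : WeierstrassCurve ℚ) [W.IsElliptic]
    [W.IsGloballyMinimal] (p : ℕ) [Fact p.Prime] [NeZero (W.conductorNorm ℤ)]
    (D : ModularParametrizationData W (W.conductorNorm ℤ)) (hsq : p ^ 2 ∣ W.conductorNorm ℤ)
    (hp5 : 5 ≤ p) (hadd : Rank1Residual.Addv W p) (hirr : Rank1Residual.Irr W p)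
    (hj : 0 ≤ padicValRat p W.j) (hW6 : padicValInt p W.minimalDiscriminantInt < 6)
    (hχ : ((quadraticChar (ZMod p)).ringHomComp (Int.castRingHom ℂ)).IsQuadratic) :
    ∃ (V W₀ : WeierstrassCurve ℚ) (_ : V.IsElliptic) (_ : V.IsGloballyMinimal) (_ : W₀.IsElliptic)
      (_ : W₀.IsGloballyMinimal) (C : VariableChange ℚ) (LV : PeriodPair)
      (D₀ : ModularParametrizationData W₀ (W.conductorNorm ℤ)),
      C • W.quadraticTwist ((-1 : ℚ) ^ (p / 2) * p) = V ∧ padicValRat p (C.u : ℚ) = 0 ∧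
      IsNeronLatticeOf (V.baseChange ℂ) LV ∧ IsIsogenous V W₀ ∧ Rank1Residual.Irr V p ∧
      (∀ z ∈ D₀.L.lattice, ∃ w ∈ periodLattice D₀.f, z = D₀.c * w) ∧
      charTwist (W.conductorNorm ℤ) (dvd_refl _) hsq hχ D.f = D₀.f := by
  have hpP : p.Prime := Fact.out
  have hp2 : p ≠ 2 := by omega
  have hprim : DirichletCharacter.IsPrimitive ((quadraticChar (ZMod p)).ringHomComp (Int.castRingHom ℂ)) :=
    isPrimitive_quadraticChar_ringHomComp p hp2
  -- the twisted minimal model `V`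
  obtain ⟨V, hVe, hVm, C, hC⟩ := exists_minimal_twist_pStar p W
  haveI := hVe
  haveI := hVm
  haveI : NeZero (V.conductorNorm ℤ) := ⟨(conductorNorm_pos_holds V).ne'⟩
  obtain ⟨hV, -, -⟩ := addv_of_twist_pStar p hp2 W V hj hW6 C hC
  obtain ⟨hu, -⟩ := padicValRat_u_eq_zero_and_padicValInt_eq_of_twist_pStar p hp2 W V hW6 C hC
  have hNV : V.conductorNorm ℤ = W.conductorNorm ℤ :=
    conductorNorm_eq_of_twist_pStar p hp5 W V hadd hV C hC
  have hd0 : ((-1 : ℚ) ^ (p / 2) * p) ≠ 0 :=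
    mul_ne_zero (pow_ne_zero _ (by norm_num)) (by exact_mod_cast hpP.ne_zero)
  haveI : (W.quadraticTwist ((-1 : ℚ) ^ (p / 2) * p)).IsElliptic := W.isElliptic_quadraticTwist hd0
  have hC' : C⁻¹ • V = W.quadraticTwist ((-1 : ℚ) ^ (p / 2) * p) := by rw [← hC, inv_smul_smul]
  have hirrV : Irr V p :=
    BurungaleSkinnerTianWan2024.hasIrreducibleModPGaloisRep_of_smul_eq_quadraticTwist W V p hd0 hC' hirr
  -- a Néron period pair of `V`
  haveI : (V.baseChange ℂ).IsElliptic := by rw [WeierstrassCurve.baseChange]; infer_instance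
  obtain ⟨LV, hLV⟩ := exists_isNeronLatticeOf_holds (V.baseChange ℂ)
  -- the optimal member `W₀` of the class of `V` and its datum at level `N`
  obtain ⟨W₀, hE₀, hM₀, hNz₀, D₀', hiso, hN₀, hopt₀'⟩ := X12.exists_isIsogenous_optimal hnf V
  haveI := hE₀
  haveI := hM₀
  haveI := hNz₀
  obtain ⟨D₀, hopt₀⟩ := exists_optimalDatum_of_level_eq' (hN₀.trans hNV) D₀' hopt₀'
  -- `f ⊗ χ` is the newform of `W₀` (q-expansion comparison)
  have hfV : IsNewformOf V D₀.f := D₀.isNewformOf.of_isIsogenous hiso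
  obtain ⟨hcast, -⟩ := pStar_intCast p
  have hvO : (primesEquiv ((primesEquiv (R := 𝓞 ℚ)).symm ⟨p, hpP⟩) : ℕ) = p := by
    rw [Equiv.apply_symm_apply]
  have haddO : ∀ (X : WeierstrassCurve ℚ) [X.IsElliptic], Addv X p →
      X.HasAdditiveReductionAt ((primesEquiv (R := 𝓞 ℚ)).symm ⟨p, hpP⟩) := by
    intro X _ hX
    set vq : HeightOneSpectrum ℤ := (primesEquiv (R := ℤ)).symm ⟨p, hpP⟩ with hvq
    have haddX : X.HasAdditiveReductionAt vq := by
      rcases X.hasGoodReductionAt_or_hasMultiplicativeReductionAt_or_hasAdditiveReductionAt vq with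
        hg | hm | ha
      · exact absurd ((X.hasGoodReductionAtPrime_iff_hasGoodReductionAt_holds ⟨p, hpP⟩).mpr hg) hX.1
      · exact absurd
          ((X.hasMultiplicativeReductionAtPrime_iff_hasMultiplicativeReductionAt_holds ⟨p, hpP⟩).mpr hm)
          hX.2
      · exact ha
    exact (X.hasAdditiveReductionAt_int_iff_ringOfIntegers ⟨p, hpP⟩).mp haddX
  have hcoef : ∀ n : ℕ,
      cuspCoeff (charTwist (W.conductorNorm ℤ) (dvd_refl _) hsq hχ D.f) n = cuspCoeff D₀.f n := by
    intro n
    rw [cuspCoeff_charTwist (W.conductorNorm ℤ) (dvd_refl _) hsq hχ hprim, D.isNewformOf.2 n,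
      hfV.2 n, quadraticChar_ringHomComp_apply_natCast p n, ← hC, LFunction_smul]
    by_cases hpn : p ∣ n
    · rw [W.LFunction_apply_eq_zero_of_hasAdditiveReductionAt hvO (haddO W hadd) hpn,
        (W.quadraticTwist ((-1 : ℚ) ^ (p / 2) * p)).LFunction_apply_eq_zero_of_hasAdditiveReductionAt
          hvO ?_ hpn]
      · push_cast; ring
      · have hV' : V.HasAdditiveReductionAt ((primesEquiv (R := 𝓞 ℚ)).symm ⟨p, hpP⟩) := haddO V hV
        rw [← hC']
        exact (hasAdditiveReductionAt_smul_iff_holds _ V C⁻¹).mpr hV'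
    · rw [← hcast, W.LFunction_quadraticTwist_pStar_apply hp2 hpn]
      have hne : ((n : ℤ) : ZMod p) ≠ 0 := by
        rw [Int.cast_natCast, Ne, ZMod.natCast_eq_zero_iff]
        exact hpn
      push_cast
      rcases legendreSym.eq_one_or_neg_one p hne with h1 | h1
      · rw [show (legendreSym p (n : ℤ)) = legendreSym p n from rfl, h1]
      · rw [show (legendreSym p (n : ℤ)) = legendreSym p n from rfl, h1]
  exact ⟨V, W₀, hVe, hVm, hE₀, hM₀, C, LV, D₀, hC, hu, hLV, hiso, hirrV, hopt₀,
    eq_of_forall_cuspCoeff_eq_gamma0 hcoef⟩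

end Summit.BirchSwinnertonDyer.BirchSwinnertonDyer.Theorems.TeichmullerTwistDescent.TwistFrame

end
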